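import Summits.BirchSwinnertonDyer.Rank1Residual.X11b.AnticyclotomicModuleFinite
import Summits.BirchSwinnertonDyer.Rank1Residual.X11b.AnticyclotomicLinks
import HarnessLib

/-!
# X11b, route R1 — the erratum-p. 4 skeleton on `X_ac^Σ(E[p^∞])` with finite generation DISCHARGED

HONEST FRAMING (cell `b2b-bsdres`, run/shared/lean/b2b/bsd-rank1-residual/, verbatim in every
file): the goal of the cell is to DELETE the COMBINATION-SHAPED residual classes of the
Birch–Swinnerton-Dyer formula for ALL analytic-rank `≤ 1` elliptic curves over `ℚ` — "full BSD
formula for every rank `≤ 1` curve in class `C`" assembled STRICTLY from published theorems — so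
that the rank-`≤ 1` remainder becomes exactly the CONSTRUCTION-SHAPED classes, which are TYPED
(missing-input `Prop`s), NOT attempted. This is not "finishing BSD". Sub-cell
`b2b-bsdres-multr1-p1` (X11b, route R1 = Castella 2018 Thm. A re-proved along the author's
erratum); a RESEARCH ROUTE; no claim beyond the stated class; X11b stays CONSTRUCTION-SHAPED;
nothing here changes a label; no named fact is minted (theorems only; no `sorry`).

## Content

Gen 8's `XAc.isTorsion_and_charIdeal_eq_of_congruences_printed` /
`XAc.hasCharValuationAt_of_congruences_printed` (`AnticyclotomicLinks.lean`: the commutative algebra of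
erratum p. 4 — "[Ski16, p. 192] applies verbatim" — instantiated on the CONSTRUCTED
`X_ac^Σ(E[p^∞])`) displayed the hypothesis `hfg : Module.Finite Λ (X_ac^Σ(E[p^∞]))` (Cas18 §2.1:
"easily shown to be a finitely generated `Λ`-module"). That hypothesis is now the THEOREM
`XAc.module_finite` (finite `Σ`; `AnticyclotomicModuleFinite.lean`), so the two theorems are restated
with `Σ` finite in place of `hfg`: `…_of_congruences_printed_of_finite`. The remaining displayed
inputs are the printed ones of erratum p. 4 (`N_m`, `e`, `hT`, `hCh` ⇐ FW21 Thm. 4.41 PREPRINT,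
`hnf`, `hc`, `L ≠ 0`). CONDITIONAL; deletes nothing.

References: [Castella2018Erratum] Thm. 1.1 and p. 4; [Castella2018] §2.1, §5 (5.1)
(arXiv:1704.06608 pp. 5, 12); [Skinner2016PacificMC] §3.1 (p. 192).
-/

noncomputable section

open scoped Classical

open WeierstrassCurve NumberField IsDedekindDomain Literature.NumberTheory.EllipticCurves
  Literature.RingTheory.FittingIdeal Summit.BirchSwinnertonDyer.Rank1Residual.X11b.AcSelmer

namespace Summit.BirchSwinnertonDyer.Rank1Residual.X11b

/-! ### 1. Erratum p. 4 on `X_ac^Σ(E[p^∞])`, finite generation discharged -/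

section Skeleton

variable {K : Type} [Field K] [NumberField K] (W : WeierstrassCurve K) [W.IsElliptic] (p : ℕ)
  [Fact p.Prime] (κ : ZpExtension K p) (𝔭 : HeightOneSpectrum (𝓞 K))
  {S : Set (HeightOneSpectrum (𝓞 K))}
  (γ : Field.absoluteGaloisGroup K) [Fact (κ.IsTopGenerator γ)]

/-- **Erratum Thm. 1.1 for finite `Σ`, kernel form, on the constructed module, `Module.Finite`
DISCHARGED**: gen 8's `XAc.isTorsion_and_charIdeal_eq_of_congruences_printed` with its hypothesis
`hfg : Module.Finite Λ (X_ac^Σ(E[p^∞]))` ("easily shown", Cas18 §2.1) replaced by `Σ` finite — now the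
theorem `XAc.module_finite`. Given the remaining printed inputs (`N_m`, `e`, `hT`, `hCh` ⇐ FW21
Thm. 4.41 PREPRINT, `hnf`, `hc`, `L ≠ 0`): `X_ac^Σ(E[p^∞])` is `Λ`-torsion and
`Ch_Λ(X_ac^Σ(E[p^∞])) = Fitt_Λ = (L)`. CONDITIONAL on the displayed inputs; deletes nothing.
[cite: Castella2018Erratum, Thm. 1.1 and proof (pp. 1, 4)] [cite: Castella2018, §2.1 (arXiv:1704.06608 p. 5), "easily shown to be a finitely generated `Λ`-module"] -/
theorem AcSelmer.XAc.isTorsion_and_charIdeal_eq_of_congruences_printed_of_finite (hS : S.Finite)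
    (N : ℕ → Type) [∀ m, AddCommGroup (N m)] [∀ m, Module (IwasawaAlgebra p) (N m)]
    [∀ m, Module.Finite (IwasawaAlgebra p) (N m)]
    {L : IwasawaAlgebra p} (hL : L ≠ 0) (Lm : ℕ → IwasawaAlgebra p)
    (e : ∀ m : ℕ, 1 ≤ m →
      ((XAc W p κ 𝔭 S γ ⧸ ((Ideal.span {(PowerSeries.C (p : ℤ_[p]) : IwasawaAlgebra p)}) ^ m •
          (⊤ : Submodule (IwasawaAlgebra p) (XAc W p κ 𝔭 S γ)))) ≃ₗ[IwasawaAlgebra p]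
        (N m ⧸ ((Ideal.span {(PowerSeries.C (p : ℤ_[p]) : IwasawaAlgebra p)}) ^ m •
          (⊤ : Submodule (IwasawaAlgebra p) (N m))))))
    (hT : ∀ m : ℕ, 1 ≤ m → Module.IsTorsion (IwasawaAlgebra p) (N m))
    (hCh : ∀ m : ℕ, 1 ≤ m → Module.charIdeal (IwasawaAlgebra p) (N m) = Ideal.span {Lm m})
    (hnf : ∀ m : ℕ, 1 ≤ m → ∀ N' : Submodule (IwasawaAlgebra p) (N m),
      Module.length (IwasawaAlgebra p) N' ≠ ⊤ → N' = ⊥)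
    (hc : ∀ m : ℕ, 1 ≤ m →
      Ideal.span {Lm m} ⊔ (Ideal.span {(PowerSeries.C (p : ℤ_[p]) : IwasawaAlgebra p)}) ^ m =
        Ideal.span {L} ⊔ (Ideal.span {(PowerSeries.C (p : ℤ_[p]) : IwasawaAlgebra p)}) ^ m) :
    Module.IsTorsion (IwasawaAlgebra p) (XAc W p κ 𝔭 S γ) ∧
      Module.fittingIdeal (IwasawaAlgebra p) (XAc W p κ 𝔭 S γ) 0 = Ideal.span {L} ∧
      XAc.charIdeal W p κ 𝔭 S γ = Ideal.span {L} :=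
  AcSelmer.XAc.isTorsion_and_charIdeal_eq_of_congruences_printed W p κ 𝔭 S γ
    (XAc.module_finite κ 𝔭 S γ hS) N hL Lm e hT hCh hnf hc

/-- **… hence "`ord_p f_ac^Σ(0) = ord_p L(0)`" on the constructed module, for finite `Σ`, without the
`Module.Finite` hypothesis** (gen 8's `XAc.hasCharValuationAt_of_congruences_printed` with `hfg`
discharged by `XAc.module_finite`). CONDITIONAL on the printed inputs of erratum p. 4.
[cite: Castella2018Erratum, Thm. 1.1 and proof (pp. 1, 4)] [cite: Castella2018, §5 (5.1) (arXiv:1704.06608 p. 12)] -/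
theorem AcSelmer.XAc.hasCharValuationAt_of_congruences_printed_of_finite (hS : S.Finite)
    (N : ℕ → Type) [∀ m, AddCommGroup (N m)] [∀ m, Module (IwasawaAlgebra p) (N m)]
    [∀ m, Module.Finite (IwasawaAlgebra p) (N m)]
    {L : IwasawaAlgebra p} (hL0 : PowerSeries.constantCoeff L ≠ 0) (Lm : ℕ → IwasawaAlgebra p)
    (e : ∀ m : ℕ, 1 ≤ m →
      ((XAc W p κ 𝔭 S γ ⧸ ((Ideal.span {(PowerSeries.C (p : ℤ_[p]) : IwasawaAlgebra p)}) ^ m •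
          (⊤ : Submodule (IwasawaAlgebra p) (XAc W p κ 𝔭 S γ)))) ≃ₗ[IwasawaAlgebra p]
        (N m ⧸ ((Ideal.span {(PowerSeries.C (p : ℤ_[p]) : IwasawaAlgebra p)}) ^ m •
          (⊤ : Submodule (IwasawaAlgebra p) (N m))))))
    (hT : ∀ m : ℕ, 1 ≤ m → Module.IsTorsion (IwasawaAlgebra p) (N m))
    (hCh : ∀ m : ℕ, 1 ≤ m → Module.charIdeal (IwasawaAlgebra p) (N m) = Ideal.span {Lm m})
    (hnf : ∀ m : ℕ, 1 ≤ m → ∀ N' : Submodule (IwasawaAlgebra p) (N m),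
      Module.length (IwasawaAlgebra p) N' ≠ ⊤ → N' = ⊥)
    (hc : ∀ m : ℕ, 1 ≤ m →
      Ideal.span {Lm m} ⊔ (Ideal.span {(PowerSeries.C (p : ℤ_[p]) : IwasawaAlgebra p)}) ^ m =
        Ideal.span {L} ⊔ (Ideal.span {(PowerSeries.C (p : ℤ_[p]) : IwasawaAlgebra p)}) ^ m) :
    XAc.HasCharValuationAt W p κ 𝔭 S γ (PowerSeries.constantCoeff L).valuation :=
  AcSelmer.XAc.hasCharValuationAt_of_congruences_printed W p κ 𝔭 S γ
    (XAc.module_finite κ 𝔭 S γ hS) N hL0 Lm e hT hCh hnf hc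

end Skeleton

end Summit.BirchSwinnertonDyer.Rank1Residual.X11b

end
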